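import Literature.MathematicalPhysics.QuantumFieldTheory.Balaban1983to89.B9Cor36GCubeFamFourCore

/-!
# `Balaban1983to89.B9Cor36BondSandwichTransferSrc` — THE BOND-SECTOR SANDWICH TRANSFER FROM THE CUBE SEQUENCE's BLOCKS TO THE MEMBER's BLOCKS FOR WORDS WITH NO
# SOURCE CUT-OFF NEAR □: `conj b(M_{g₁}∘R(γ)⁻¹∘M∘R(γ)) ≺ (M₂Σ‖b‖)²·K` over the member from `conj b(M) ≺ B_C·w(a)·e^{−δd_□}` over the cube sequence, paying ONE
# [4]-(2.61) sum for the splitting of a member source block into cube blocks — and the member-side majorant per cube of the `hV′` word `M_{h_□}·O_□·P1l_□` of the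
# fourth family of (3.106) (sub-row G-B9-LETTERS, module M5.1b-G, GAPS G-B9-07; programme FAMFOUR, FILE α-T — the source-global twin of G-F6b-T)

T. Bałaban, *Propagators for lattice gauge theories in a background field*, Commun. Math. Phys. **99** (1985) 389–434
[`Balaban1985BackgroundPropagators`, "B9"]; [4] = T. Bałaban, *Propagators and renormalization transformations for lattice gauge
theories. II*, Commun. Math. Phys. **96** (1984) 223–250 [`Balaban1984PropagatorsII`].

statement-level skeleton of published theorems with citation tags; proofs where landed; nothing here is a claim about the
Yang–Mills mass gap

THE PRINTED LOCUS (verbatim up to notation; page owner r06).  [B9] p. 408: «Let us take a cube □ ∈ 𝒟_j and let us define a sequence {Ω_n(□)}_{n=0,…,j+1} …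
Ω_n(□) is a cube with a center at the center of □ …»; p. 409 l. 1–5: «The operators constructed for this sequence, which we denote by G′_□(U), C_□(U), G_□(U), satisfy
all the inequalities of Theorems 3.1–3.3 correspondingly. This is the basis of all estimates for the expansions we will construct»; (3.106) p. 414 (the transposed
law `G₀Δ_a = I − R′`, whose fourth family is `Σ_□ h_□G_□P′_{□,1}(∂h_□)ζ_□̃`-shaped: the cube letter stands at the SOURCE end); Cor. 3.6 p. 408 l. 11–14; [4] (2.46)
p. 231 (the scaled distance), (2.51)–(2.52) p. 232 («|(Tλ)(x)| ≦ K(y,y′)|λ|», «this property is preserved under the composition»), Lemma 2.1 (2.61) p. 234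
(«Σ_{y′} e^{−αδ₀d(y,y′)} ≦ c₁»).

WHY THIS FILE (cell `lit-balaban`; seat p38 gen 46; lead g34 RULING FAMFOUR SPLIT 2026-08-28T22:32:55Z «α-T = the programme's new M-size mathematics, source-global
twin of your own G-F6b-T — author = you»).  G-F6b-T `B9Cor36BondSandwichTransfer.hasMajorant_conj_bond_sandwich` carries a cube-side block majorant of `conj b(M)` to the
member's blocks for sandwiches `M_{g₁}R(γ)⁻¹MR(γ)M_{g₂}` whose SOURCE cut-off `g₂` lives near □ — there a member block IS a cube block (r05's `lev_cubeFam_eq_of_nearH`).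
The `hV′` word of the fourth family, `M_{h_□}·O_□·P1l_□ = M_{h_□}∘R(u)⁻¹∘[M_{χ_□}G_□(Ṽ)M_{χ_□}P_{□,1}(∂h_□)(Ṽ)]∘R(u)` (α-2 `famFourT_eq_sandwich`), has NO source cut-off:
away from `C₁(□)` the cube family has level `0` (r05 `lev_cubeFam_eq_zero`), so a member source block `y′` splits into many cube blocks.  THIS FILE proves the
transfer in that generality: a member source `μ` supported in `y′` is split into its cube-block pieces `μ = Σ_s μ|_s` (each a cube-side source with the same
bound), the cube-side majorant bounds each piece by `B_C·w(a)·e^{−δd_□(a,s)}`, the pieces that are not under `y′` vanish, the others have `d(a,y′) ≤ d_□(a,s)`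
(p38's `dist_member_le_dist_cube`), and `e^{−δd_□} ≤ e^{−(1−α)δd(a,y′)}·e^{−αδd_□(a,s)}` leaves ONE sum `Σ_s e^{−αδd_□(a,s)} ≤ c₁(δ,α)` — [4] (2.61) on the cube
geometry (p33's `exists_h261_geoCK`).  §2 applies it to the `hV′` word per cube with p33's ROW indicator (the cover sum and the `ℓ(a)ℓ(a′)⁻¹` currency are α-3).

WHAT THIS FILE PROVES (THEOREMS; 0 `def`, 0 `def … : Prop`, 0 sorry; standard axioms).
* §1 ★★★ `hasMajorant_conj_bond_sandwich_src_global` — for a bi-contractive unit field `γ`, a real row multiplier `|g₁| ≤ G₁∘Δ_□`, a cube-side majorant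
  `conj b(M) ≺ B_C·w(a)·e^{−δ·d_□(a,s)}` over `(toB6 (geoCK i □) Rr H, blkBK i □)` (`w ≥ 0`, `δ ≥ 0`), (2.61) `Ineq261 dB (toB6 (geoCK i □) Rr H) δ α` (`α ≤ 1`) and any
  member kernel `K` with `G₁(Δ_□x)·w(Δ_□x)·B_C·c₁(δ,α)·e^{−(1−α)δ·d(Δ(x),a′)} ≤ K(Δ(x),a′)` for all bonds `x` and member blocks `a′`:
  `conj b(M_{g₁}∘R(γ)⁻¹∘M∘R(γ)) ≺ (M₂Σ‖b_j‖)²·K` over the member's `(toB6 (geo9K i) Rr′ Hp, ιB∘blkV1)`.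
* §2 ★★ `hasMajorant_conj_famFourT_of_core` (any cube kernel of the decay shape `B_C·e^{−δd_□}` for the core `M_{χ_□}G_□(Ṽ)M_{χ_□}P_{□,1}(∂h_□)(Ṽ)`) and ★★
  `hasMajorant_conj_famFourT` (under α-2's `hasMajorant_core_F4T` data + (2.61) at the splitting exponent): the member-side majorant PER CUBE of the `hV′` word
  `conj b((M_{h_□}·O_□·P1l_□)^ℝ) ≺ (M₂Σ‖b_j‖)²·𝟙^row_□(a)·(B_GK₁Λc₁(δ₀,a₁−ρ)·c₁(ρδ₀,α))·e^{−(1−α)ρδ₀·d(a,a′)}`, `𝟙^row_□` = p33's D2 row indicator (summable over □ by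
  D3's `sum_rowInd_le`); the `M⁻¹` sits in `K₁` (α-1).

HONEST SCOPE ∕ NOT CLAIMED.  Finite operator algebra + [4] (2.51)∕(2.61) bookkeeping over landed modules; the price of the missing source cut-off is exactly one factor
`c₁(δ,α)` and the part `α` of the rate; block-majorant (operator) form; print needs no such transfer (its `G_□`, `P_□` live on the cube sequence and its kernel
bounds are pointwise) — this is (R)-design bookkeeping for def-Y's member-level majorants, NOT a statement of the paper.  NOT here: the cover sums, the `hV′`
currency `ℓ(a)ℓ(a′)⁻¹` (α-3, p33's `scaleTransfer_len_geo9K` pattern), families 2–3.  NOT a node discharge; no summit ∕ sub-problem statement is proved; nothing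
continuum ∕ OS ∕ mass-gap ∕ Clay; YM mass gap NOT proved by any of this (Track A conditional rung).  No `sorry`, no `axiom`, no `… : Prop` fact, no `instance`, no
`notation`, no `def`.  NEW file; nothing landed is modified.  `--supports stmt-QuantumFields-19200` as helper.  Net new unproved facts: 0.

RELATED IN THE TREE, NOT DUPLICATED (searched 2026-08-28: `rg 'src_global|srcGlobal|SandwichTransferSrc' Literature/` = ∅): p38 G-F6b-T `B9Cor36BondSandwichTransfer`
(source cut-off near □ — the pattern followed; `norm_le_sum_mul_of_repr_le`, `dist_member_le_dist_cube` USED BY NAME), r05 `B9CubeCoarsening.majorant_transfer_of_nearH`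
(scalar, near □), p21 `B9Cor36CinvCubeLocLetterMajorant.hasMajorant_conj_bridge_sandwich` (block carriers with a bridge), α-2 `B9Cor36GCubeFamFourCore`
(`famFourT_eq_sandwich`, `hasMajorant_core_F4T`), p33 D1 `abs_hBdY_hTY_le_indicator`.
-/

noncomputable section

namespace Literature.MathematicalPhysics.QuantumFieldTheory.Balaban1983to89.B9Cor36BondSandwichTransferSrc

open B6RandomWalk (HasMajorant BlockSupp hasMajorant_mono Ineq261 c1_nonneg)
open B9Thm34Ext (toB6)
open B9Ineq347 (ScaleTransfer)
open B9Eq39Adjoint (R R_zero R_smul)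
open B9Eq310Hermitian (norm_R_le norm_R_inv_le)
open B9Eq352DivFormLetters (conj conj_apply coordEquiv coordEquiv_apply coordEquiv_symm_apply norm_coordSymm_apply_le)
open B6KLevelCensusIndexV1 (KIdx kGeo)
open B6Cover236MultiLevelBlocks (cubes)
open B6Geom246MultiLevelBox (bset blkOf)
open B6GlobalChartV1 (blkV1)
open B6Ineq2142KLevelV1 (β)
open B9GeoNormsKLevelV1 (geo9K)
open B9CubeLettersBondOpsL0 (BlkCubeY GACubeY)
open B9Eq360DeltaPrimeACubeY (blkCubeY)
open B9CubeGeometryInputs (geoCK geoCK_len_pos geoCK_dist_axioms)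
open B9Thm37CubeCoverCommutators (cutMulY cutMulY_apply hTY hTY_apply)
open B9Eq3104CutoffCommutators (hBdY hBdY_apply)
open B9Eq3105AtLetters (P1CubeY)
open B9Cor36CinvCubeLocLetterMajorant (norm_le_sum_mul_of_repr_le)
open B9Cor36SiteSandwichTransfer (dist_member_le_dist_cube)
open B9Cor35GCubeInputsAtOne (blkBK GVK)
open B9Cor36CubeCutoffs (chiY)
open B9Cor36GCubeLocLetter (locLetterBY locP1BY)
open B9Cor36GCubeLocDefectTransfer (abs_hBdY_hTY_le_indicator)
open B9Cor36GCubeFamFourCore (famFourT_eq_sandwich hasMajorant_core_F4T)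
open Node00 (SiteY BlkY IBondY FBondY CfgY GaugeY SiteParY BondParY conjY conjY_apply toKT gBondY)
open Node00.OpsYNablaBridge (chartY)

variable {d ℓ : ℕ} {hd : 1 ≤ d + 1} {hL : Odd (ℓ + 1) ∧ 1 < ℓ + 1} {b₀ b₁ : ℝ}
variable {𝔸 : Type} [NormedRing 𝔸] [NormedAlgebra ℂ 𝔸] [CompleteSpace 𝔸]
variable {ι : Type} [Fintype ι]

/-! ## §1  ★★★ The source-global sandwich transfer: cube-sequence blocks → member blocks, one (2.61) sum for the splitting of the source block -/

section Transfer

variable (i : KIdx d ℓ hd hL b₀ b₁) (c : ↥(cubes (toKT i).D.toDomains)) (b : Module.Basis ι ℝ 𝔸)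

/-- `e^{−δD} ≤ e^{−(1−α)δd}·e^{−αδD}` for `0 ≤ δ`, `α ≤ 1`, `d ≤ D`. [cite: Balaban1984PropagatorsII, (2.61) p.234, bookkeeping] -/
theorem exp_split_le {δ α dm D : ℝ} (hδ : 0 ≤ δ) (hα1 : α ≤ 1) (hd : dm ≤ D) :
    Real.exp (-(δ * D)) ≤ Real.exp (-((1 - α) * δ * dm)) * Real.exp (-(α * δ * D)) := by
  rw [← Real.exp_add]
  refine Real.exp_le_exp.2 ?_
  have h1 : 0 ≤ (1 - α) * δ := mul_nonneg (by linarith) hδ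
  nlinarith [mul_le_mul_of_nonneg_left hd h1]

omit [CompleteSpace 𝔸] in
/-- ★★★ **THE SOURCE-GLOBAL BOND SANDWICH TRANSFER.**  Let `γ` be a bi-contractive unit field on fine bonds (`‖R(γ)a‖, ‖R(γ)⁻¹a‖ ≤ ‖a‖`), `g₁` a real row multiplier with
`|g₁(f)| ≤ G₁(Δ_□(f₋))`, and let the realified cube-side operator `conj b(M)` have the block majorant `B_C·w(a)·e^{−δ·d_□(a,s)}` over the cube sequence's blocks
`(toB6 (geoCK i □) Rr H, blkBK i □)` (`w ≥ 0`, `δ ≥ 0`); assume (2.61) on the cube geometry at the splitting exponent `α ≤ 1` and let the member kernel `K`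
dominate `G₁(Δ_□x)·w(Δ_□x)·B_C·c₁(δ,α)·e^{−(1−α)δ·d(Δ(x),a′)}` for every bond `x` and member block `a′`.  Then
`conj b(M_{g₁}∘R(γ)⁻¹∘M∘R(γ)) ≺ (M₂Σ‖b_j‖)²·K` over the member's blocks `(toB6 (geo9K i) Rr′ Hp, ιB∘blkV1)`.  Mechanism: a member source in the block `y′` splits into
its cube-block pieces (same bound each, `R(γ)` contracts); pieces outside `y′` vanish, the others have `d(a,y′) ≤ d_□(a,s)` (distances shrink under coarsening), and the
splitting costs `Σ_s e^{−αδd_□(a,s)} ≤ c₁`.  NO source cut-off, NO nearness to □ is needed.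
[cite: Balaban1985BackgroundPropagators, Cor. 3.6 p.408 l.11–14, p.409 l.1–5, (3.106) p.414; Balaban1984PropagatorsII, (2.51)–(2.52) p.232, (2.46) p.231, Lemma 2.1 (2.61) p.234] -/
theorem hasMajorant_conj_bond_sandwich_src_global {M₂ : ℝ} (hM₂ : 0 ≤ M₂) (hrepr : ∀ (v : 𝔸) (j : ι), |b.repr v j| ≤ M₂ * ‖v‖)
    (γ : FBondY i → 𝔸ˣ) (hγ : ∀ f a, ‖R (γ f) a‖ ≤ ‖a‖ ∧ ‖R (γ f)⁻¹ a‖ ≤ ‖a‖)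
    (g₁ : FBondY i → ℝ) (G₁ : BlkCubeY i c → ℝ) (hG₁ : ∀ f, |g₁ f| ≤ G₁ (blkCubeY i c (chartY i f.src)))
    (ιB : BlkY i → IBondY i) (hι : ∀ s, β i.hN i.D i.hk (ιB s) = s) (Rr : ℝ) (H : Prop) [Fintype (geo9K i).Site] (Rr' : ℝ) (Hp : Prop)
    (dB : ℕ) {BC δ α : ℝ} (hBC : 0 ≤ BC) (hδ : 0 ≤ δ) (hα1 : α ≤ 1) (w : BlkCubeY i c → ℝ) (hw : ∀ s, 0 ≤ w s)
    (h261 : Ineq261 dB (toB6 (geoCK i c) Rr H) δ α)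
    {K : IBondY i → IBondY i → ℝ}
    (hcmp : ∀ (x : FBondY i) (a' : IBondY i),
      G₁ (blkCubeY i c (chartY i x.src)) * w (blkCubeY i c (chartY i x.src)) * (BC * B6.c1 dB δ α) *
          Real.exp (-((1 - α) * δ * (geo9K i).dist (ιB (blkOf i.D.toDomains (chartY i x.src))) a')) ≤
        K (ιB (blkOf i.D.toDomains (chartY i x.src))) a')
    (M : Module.End ℝ (FBondY i → 𝔸))
    (hM : HasMajorant (g := toB6 (geoCK i c) Rr H) (blkBK i c) (conj b M) (fun a s => BC * w a * Real.exp (-(δ * (geoCK i c).dist a s)))) :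
    HasMajorant (g := toB6 (geo9K i) Rr' Hp) (fun p : FBondY i × ι => ιB (blkV1 i.hN i.D p.1))
      (conj b ((cutMulY (𝔸 := 𝔸) g₁).restrictScalars ℝ ∘ₗ (conjY γ⁻¹).restrictScalars ℝ ∘ₗ M ∘ₗ (conjY γ).restrictScalars ℝ))
      (fun a a' => (M₂ * ∑ j, ‖b j‖) ^ 2 * K a a') := by
  classical
  intro y' μ B hμ x
  have hSb : 0 ≤ ∑ j, ‖b j‖ := Finset.sum_nonneg fun _ _ => norm_nonneg _
  have hc1 : 0 ≤ B6.c1 dB δ α := c1_nonneg _ _ _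
  -- the source as an `𝔸`-valued bond function, rotated; its cube-block pieces
  set lam : FBondY i → 𝔸 := (coordEquiv b).symm μ with hlam
  set ν : FBondY i → 𝔸 := conjY γ lam with hν
  set νs : BlkCubeY i c → FBondY i → 𝔸 := fun s v => if blkCubeY i c (chartY i v.src) = s then ν v else 0 with hνs
  have hsum : ν = ∑ s, νs s := by
    funext v
    rw [Finset.sum_apply]
    simp only [hνs]
    rw [Finset.sum_ite_eq]
    simp only [Finset.mem_univ, if_true]
  rw [conj_apply]
  simp only [LinearMap.comp_apply, LinearMap.restrictScalars_apply]
  rw [← hlam]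
  change |b.repr (cutMulY g₁ (conjY γ⁻¹ (M ν)) x.1) x.2| ≤ (M₂ * ∑ j, ‖b j‖) ^ 2 * K (ιB (blkV1 i.hN i.D x.1)) y' * B
  rw [cutMulY_apply, conjY_apply, Pi.inv_apply]
  -- the row factor
  have hG₁0 : 0 ≤ G₁ (blkCubeY i c (chartY i x.1.src)) := (abs_nonneg _).trans (hG₁ x.1)
  have hrowfac : |b.repr ((((g₁ x.1 : ℝ) : ℂ)) • R (γ x.1)⁻¹ (M ν x.1)) x.2| ≤ M₂ * (G₁ (blkCubeY i c (chartY i x.1.src)) * ‖M ν x.1‖) := by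
    refine (hrepr _ _).trans (mul_le_mul_of_nonneg_left ?_ hM₂)
    rw [norm_smul, Complex.norm_real, Real.norm_eq_abs]
    exact mul_le_mul (hG₁ x.1) ((hγ x.1 _).2) (norm_nonneg _) hG₁0
  -- the source: values bounded by `(Σ‖b‖)·B`, zero off the member block over `y′`
  have hlam_bd : ∀ v, ‖lam v‖ ≤ (∑ j, ‖b j‖) * B := fun v => by
    by_cases hv : ιB (blkV1 i.hN i.D v) = y'
    · rw [hlam]; exact norm_coordSymm_apply_le b μ v B fun j => hμ.bound (v, j) hv
    · have h0 : lam v = 0 := by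
        rw [hlam, coordEquiv_symm_apply]
        exact Finset.sum_eq_zero fun j _ => by rw [hμ.off (v, j) hv, zero_smul]
      rw [h0, norm_zero]; exact mul_nonneg hSb hμ.nonneg
  have hlam_off : ∀ v, ιB (blkV1 i.hN i.D v) ≠ y' → lam v = 0 := fun v hv => by
    rw [hlam, coordEquiv_symm_apply]
    exact Finset.sum_eq_zero fun j _ => by rw [hμ.off (v, j) hv, zero_smul]
  have hν_val : ∀ v, ν v = R (γ v) (lam v) := fun v => by rw [hν, conjY_apply]
  have hν_bd : ∀ v, ‖ν v‖ ≤ (∑ j, ‖b j‖) * B := fun v => by rw [hν_val]; exact ((hγ v _).1).trans (hlam_bd v)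
  -- each piece is a cube-side source supported in its cube block
  have hνsupp : ∀ s, BlockSupp (g := toB6 (geoCK i c) Rr H) (blkBK i c) (coordEquiv b (νs s)) s (M₂ * ((∑ j, ‖b j‖) * B)) := fun s => by
    refine ⟨mul_nonneg hM₂ (mul_nonneg hSb hμ.nonneg), fun p hp => ?_, fun p hp => ?_⟩
    · rw [coordEquiv_apply]
      refine (hrepr _ _).trans (mul_le_mul_of_nonneg_left ?_ hM₂)
      simp only [hνs]
      split_ifs
      · exact hν_bd p.1
      · rw [norm_zero]; exact mul_nonneg hSb hμ.nonneg
    · rw [coordEquiv_apply]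
      have hp' : ¬ blkCubeY i c (chartY i p.1.src) = s := hp
      simp only [hνs, if_neg hp', map_zero, Finsupp.zero_apply]
  -- the cube-side majorant on each piece
  have hpiece : ∀ s, ‖M (νs s) x.1‖ ≤
      (∑ j, ‖b j‖) * (BC * w (blkCubeY i c (chartY i x.1.src)) * Real.exp (-(δ * (geoCK i c).dist (blkCubeY i c (chartY i x.1.src)) s)) *
        (M₂ * ((∑ j, ‖b j‖) * B))) := fun s =>
    norm_le_sum_mul_of_repr_le b _ fun j' => by
      have h := hM s (coordEquiv b (νs s)) _ (hνsupp s) (x.1, j')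
      rwa [conj_apply, LinearEquiv.symm_apply_apply] at h
  -- inactive pieces vanish; active pieces lie under `y′`, where `d(a,y′) ≤ d_□(a,s)`
  set Em : ℝ := Real.exp (-((1 - α) * δ * (geo9K i).dist (ιB (blkV1 i.hN i.D x.1)) y')) with hEm
  have hwB : 0 ≤ BC * w (blkCubeY i c (chartY i x.1.src)) := mul_nonneg hBC (hw _)
  have hMB : 0 ≤ M₂ * ((∑ j, ‖b j‖) * B) := mul_nonneg hM₂ (mul_nonneg hSb hμ.nonneg)
  have hpiece' : ∀ s, ‖M (νs s) x.1‖ ≤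
      (∑ j, ‖b j‖) * (BC * w (blkCubeY i c (chartY i x.1.src)) * (Em * Real.exp (-(α * δ * (geoCK i c).dist (blkCubeY i c (chartY i x.1.src)) s))) *
        (M₂ * ((∑ j, ‖b j‖) * B))) := fun s => by
    by_cases hs : ∃ v₀, lam v₀ ≠ 0 ∧ blkCubeY i c (chartY i v₀.src) = s
    · obtain ⟨v₀, hv₀, hs₀⟩ := hs
      have hy' : ιB (blkV1 i.hN i.D v₀) = y' := by
        by_contra h; exact hv₀ (hlam_off v₀ h)
      have hdD := dist_member_le_dist_cube i c ιB hι (chartY i x.1.src) (chartY i v₀.src)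
      have hy'' : ιB (blkOf i.D.toDomains (chartY i v₀.src)) = y' := hy'
      rw [hs₀, hy''] at hdD
      refine (hpiece s).trans (mul_le_mul_of_nonneg_left (mul_le_mul_of_nonneg_right (mul_le_mul_of_nonneg_left ?_ hwB) hMB) hSb)
      rw [hEm]
      exact exp_split_le hδ hα1 hdD
    · have h0 : νs s = 0 := funext fun v => by
        simp only [hνs]
        split_ifs with hv
        · have hl : lam v = 0 := by
            by_contra hl; exact hs ⟨v, hl, hv⟩
          rw [hν_val, hl, R_zero]; rfl
        · rfl
      rw [h0, map_zero, Pi.zero_apply, norm_zero]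
      exact mul_nonneg hSb (mul_nonneg (mul_nonneg hwB (mul_nonneg (Real.exp_nonneg _) (Real.exp_nonneg _))) hMB)
  -- summing the pieces: one (2.61) sum
  have hMν : M ν x.1 = ∑ s, M (νs s) x.1 := by
    rw [hsum, map_sum, Finset.sum_apply]
  have h261x := h261 (blkCubeY i c (chartY i x.1.src))
  have hnorm : ‖M ν x.1‖ ≤ (∑ j, ‖b j‖) * (BC * w (blkCubeY i c (chartY i x.1.src)) * (Em * B6.c1 dB δ α) * (M₂ * ((∑ j, ‖b j‖) * B))) := by
    rw [hMν]
    refine (norm_sum_le _ _).trans ((Finset.sum_le_sum fun s _ => hpiece' s).trans ?_)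
    have hfac : ∀ s : BlkCubeY i c,
        (∑ j, ‖b j‖) * (BC * w (blkCubeY i c (chartY i x.1.src)) * (Em * Real.exp (-(α * δ * (geoCK i c).dist (blkCubeY i c (chartY i x.1.src)) s))) *
          (M₂ * ((∑ j, ‖b j‖) * B))) =
        ((∑ j, ‖b j‖) * (BC * w (blkCubeY i c (chartY i x.1.src)) * Em * (M₂ * ((∑ j, ‖b j‖) * B)))) *
          Real.exp (-(α * δ * (geoCK i c).dist (blkCubeY i c (chartY i x.1.src)) s)) := fun s => by ring
    simp_rw [hfac]
    rw [← Finset.mul_sum]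
    calc ((∑ j, ‖b j‖) * (BC * w (blkCubeY i c (chartY i x.1.src)) * Em * (M₂ * ((∑ j, ‖b j‖) * B)))) *
          ∑ s, Real.exp (-(α * δ * (geoCK i c).dist (blkCubeY i c (chartY i x.1.src)) s))
        ≤ ((∑ j, ‖b j‖) * (BC * w (blkCubeY i c (chartY i x.1.src)) * Em * (M₂ * ((∑ j, ‖b j‖) * B)))) * B6.c1 dB δ α :=
          mul_le_mul_of_nonneg_left h261x (mul_nonneg hSb (mul_nonneg (mul_nonneg hwB (Real.exp_nonneg _)) hMB))
      _ = _ := by ring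
  -- assembling
  have hc : G₁ (blkCubeY i c (chartY i x.1.src)) * w (blkCubeY i c (chartY i x.1.src)) * (BC * B6.c1 dB δ α) * Em ≤ K (ιB (blkV1 i.hN i.D x.1)) y' :=
    hcmp x.1 y'
  calc |b.repr ((((g₁ x.1 : ℝ) : ℂ)) • R (γ x.1)⁻¹ (M ν x.1)) x.2| ≤ M₂ * (G₁ (blkCubeY i c (chartY i x.1.src)) * ‖M ν x.1‖) := hrowfac
    _ ≤ M₂ * (G₁ (blkCubeY i c (chartY i x.1.src)) *
          ((∑ j, ‖b j‖) * (BC * w (blkCubeY i c (chartY i x.1.src)) * (Em * B6.c1 dB δ α) * (M₂ * ((∑ j, ‖b j‖) * B))))) :=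
        mul_le_mul_of_nonneg_left (mul_le_mul_of_nonneg_left hnorm hG₁0) hM₂
    _ = (M₂ * ∑ j, ‖b j‖) ^ 2 * (G₁ (blkCubeY i c (chartY i x.1.src)) * w (blkCubeY i c (chartY i x.1.src)) * (BC * B6.c1 dB δ α) * Em) * B := by ring
    _ ≤ (M₂ * ∑ j, ‖b j‖) ^ 2 * K (ιB (blkV1 i.hN i.D x.1)) y' * B :=
        mul_le_mul_of_nonneg_right (mul_le_mul_of_nonneg_left hc (sq_nonneg _)) hμ.nonneg

end Transfer

/-! ## §2  The member-side majorant per cube of the `hV′` word `M_{h_□}·O_□·P1l_□` (row indicator of the blocks meeting `supp h_□`) -/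

section FamFourT

variable (i : KIdx d ℓ hd hL b₀ b₁) (c : ↥(cubes (toKT i).D.toDomains)) (parS : SiteParY 𝔸 i) (parB : BondParY 𝔸 i) (b : Module.Basis ι ℝ 𝔸)

open Classical in
/-- ★★ **THE MEMBER-SIDE MAJORANT OF `conj b((M_{h_□}·O_□·P1l_□)^ℝ)` FROM ONE CUBE-SIDE DECAY DATUM**: a cube-side majorant `B_C·e^{−δd_□}` of the realified core
`M_{χ_□}G_□(Ṽ)M_{χ_□}P_{□,1}(∂h_□)(Ṽ)`, a bi-contractive gauge `u`, and (2.61) at the splitting exponent `α ≤ 1` give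
`≺ (M₂Σ‖b_j‖)²·𝟙^row_□(a)·(B_C·c₁(δ,α))·e^{−(1−α)δ·d(a,a′)}` over the member's blocks, `𝟙^row_□(a)` = «the member block `a` holds a bond whose cube block meets `supp h_□`»
(p33's D2 indicator; `|h_□♭| ≤ 𝟙^row` is D1's `abs_hBdY_hTY_le_indicator`).
[cite: Balaban1985BackgroundPropagators, (3.106) p.414, (3.87) p.409, Cor. 3.6 p.408; Balaban1984PropagatorsII, (2.51)–(2.55) p.232, Lemma 2.1 (2.61) p.234] -/
theorem hasMajorant_conj_famFourT_of_core {M₂ : ℝ} (hM₂ : 0 ≤ M₂) (hrepr : ∀ (v : 𝔸) (j : ι), |b.repr v j| ≤ M₂ * ‖v‖)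
    (g : GaugeY 𝔸 i) (hg : ∀ x, ‖((g x : 𝔸ˣ) : 𝔸)‖ ≤ 1 ∧ ‖(((g x)⁻¹ : 𝔸ˣ) : 𝔸)‖ ≤ 1) (V : CfgY 𝔸 i)
    (ιB : BlkY i → IBondY i) (hι : ∀ s, β i.hN i.D i.hk (ιB s) = s) (Rr : ℝ) (H : Prop) [Fintype (geo9K i).Site] (Rr' : ℝ) (Hp : Prop)
    (dB : ℕ) {BC δ α : ℝ} (hBC : 0 ≤ BC) (hδ : 0 ≤ δ) (hα1 : α ≤ 1) (h261 : Ineq261 dB (toB6 (geoCK i c) Rr H) δ α)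
    (hFT : HasMajorant (g := toB6 (geoCK i c) Rr H) (blkBK i c)
      (conj b ((cutMulY (𝔸 := 𝔸) (hBdY i (chiY i c)) * GACubeY i c parS parB V * cutMulY (hBdY i (chiY i c)) * P1CubeY i c (hTY i c) parS V).restrictScalars ℝ))
      (fun a s => BC * Real.exp (-(δ * (geoCK i c).dist a s)))) :
    HasMajorant (g := toB6 (geo9K i) Rr' Hp) (fun p : FBondY i × ι => ιB (blkV1 i.hN i.D p.1))
      (conj b ((cutMulY (𝔸 := 𝔸) (hBdY i (hTY i c)) * locLetterBY i c parS parB g (chiY i c) V * locP1BY i c parS g (hTY i c) V).restrictScalars ℝ))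
      (fun a a' => (M₂ * ∑ j, ‖b j‖) ^ 2 *
        ((if ∃ x : FBondY i, ιB (blkOf i.D.toDomains (chartY i x.src)) = a ∧
              ∃ z : SiteY i, blkCubeY i c z = blkCubeY i c (chartY i x.src) ∧ hTY i c z ≠ 0 then BC * B6.c1 dB δ α else 0) *
          Real.exp (-((1 - α) * δ * (geo9K i).dist a a')))) := by
  have hγ : ∀ (f : FBondY i) (a : 𝔸), ‖R (gBondY i g f) a‖ ≤ ‖a‖ ∧ ‖R (gBondY i g f)⁻¹ a‖ ≤ ‖a‖ := fun f a =>
    ⟨norm_R_le (hg _).1 (hg _).2 a, norm_R_inv_le (hg _).1 (hg _).2 a⟩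
  have hκ : 0 ≤ BC * B6.c1 dB δ α := mul_nonneg hBC (c1_nonneg _ _ _)
  have hFT' : HasMajorant (g := toB6 (geoCK i c) Rr H) (blkBK i c)
      (conj b ((cutMulY (𝔸 := 𝔸) (hBdY i (chiY i c)) * GACubeY i c parS parB V * cutMulY (hBdY i (chiY i c)) * P1CubeY i c (hTY i c) parS V).restrictScalars ℝ))
      (fun a s => BC * (fun _ : BlkCubeY i c => (1 : ℝ)) a * Real.exp (-(δ * (geoCK i c).dist a s))) :=
    hasMajorant_mono (g := toB6 (geoCK i c) Rr H) _ hFT fun a s => by rw [mul_one]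
  rw [famFourT_eq_sandwich]
  refine hasMajorant_conj_bond_sandwich_src_global i c b hM₂ hrepr (gBondY i g) hγ (hBdY i (hTY i c))
    (fun a => if ∃ z : SiteY i, blkCubeY i c z = a ∧ hTY i c z ≠ 0 then (1 : ℝ) else 0) (abs_hBdY_hTY_le_indicator i c)
    ιB hι Rr H Rr' Hp dB hBC hδ hα1 (fun _ => 1) (fun _ => zero_le_one) h261 (fun x a' => ?_) _ hFT'
  by_cases hx : ∃ z : SiteY i, blkCubeY i c z = blkCubeY i c (chartY i x.src) ∧ hTY i c z ≠ 0
  · rw [if_pos hx, if_pos ⟨x, rfl, hx⟩, one_mul, one_mul]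
  · rw [if_neg hx, zero_mul, zero_mul, zero_mul]
    exact mul_nonneg (by split_ifs <;> [exact hκ; exact le_rfl]) (Real.exp_nonneg _)

open Classical in
set_option maxHeartbeats 1600000 in
/-- ★★ **THE MEMBER-SIDE MAJORANT OF THE `hV′` WORD PER CUBE** (the fourth family of (3.106) at the (R)-design letters, modulo the cover sum and the `ℓ(a)ℓ(a′)⁻¹`
currency): under the data of α-2's `hasMajorant_core_F4T` (`hG`, `hP1`, (2.61) at `a₁ − ρ`, the transfer of `ℓ_□⁻²`, `α_st + ρ ≤ b_G`), a bi-contractive gauge `u`,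
and (2.61) at the splitting exponent `α ≤ 1` for the rate `ρδ₀`:
`conj b((M_{h_□}·O_□·P1l_□)^ℝ) ≺ (M₂Σ‖b_j‖)²·𝟙^row_□(a)·(B_GK₁Λ·c₁(δ₀, a₁ − ρ)·c₁(ρδ₀, α))·e^{−(1−α)ρδ₀·d(a,a′)}` over the member's `(toB6 (geo9K i) Rr′ Hp, ιB∘blkV1)`;
the `M⁻¹` sits in `K₁` (α-1).
[cite: Balaban1985BackgroundPropagators, (3.106) p.414, p.414 (after (3.103)), (3.87) p.409, Cor. 3.6 p.408; Balaban1984PropagatorsII, (2.83)–(2.85) pp.237–238, (2.51)–(2.55) p.232, Lemma 2.1 (2.61) p.234] -/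
theorem hasMajorant_conj_famFourT {M₂ : ℝ} (hM₂ : 0 ≤ M₂) (hrepr : ∀ (v : 𝔸) (j : ι), |b.repr v j| ≤ M₂ * ‖v‖)
    (g : GaugeY 𝔸 i) (hg : ∀ x, ‖((g x : 𝔸ˣ) : 𝔸)‖ ≤ 1 ∧ ‖(((g x)⁻¹ : 𝔸ˣ) : 𝔸)‖ ≤ 1) (V : CfgY 𝔸 i)
    (ιB : BlkY i → IBondY i) (hι : ∀ s, β i.hN i.D i.hk (ιB s) = s) (Rr : ℝ) (H : Prop) [Fintype (geo9K i).Site] (Rr' : ℝ) (Hp : Prop)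
    (dB : ℕ) {δ₀ a1 bG αst ρ K1 BG Λ α : ℝ}
    (hδ₀ : 0 ≤ δ₀) (hK1 : 0 ≤ K1) (hBG : 0 ≤ BG) (hΛ : 0 ≤ Λ) (hρ : 0 ≤ ρ) (hsplit : αst + ρ ≤ bG) (hα1 : α ≤ 1)
    (h261 : Ineq261 dB (toB6 (geoCK i c) Rr H) δ₀ (a1 - ρ)) (h261s : Ineq261 dB (toB6 (geoCK i c) Rr H) (ρ * δ₀) α)
    (hST : ScaleTransfer (geoCK i c) δ₀ αst Λ (fun a => ((geoCK i c).len a ^ 2)⁻¹))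
    (hG : HasMajorant (g := toB6 (geoCK i c) Rr H) (blkBK i c) (GVK b i c parS parB V)
      (fun a y => BG * (geoCK i c).len a ^ 2 * Real.exp (-(bG * δ₀ * (geoCK i c).dist a y))))
    (hP1 : HasMajorant (g := toB6 (geoCK i c) Rr H) (blkBK i c) (conj b ((P1CubeY i c (hTY i c) parS V).restrictScalars ℝ))
      (fun y b' => K1 * ((geoCK i c).len y ^ 2)⁻¹ * Real.exp (-(a1 * δ₀ * (geoCK i c).dist y b')))) :
    HasMajorant (g := toB6 (geo9K i) Rr' Hp) (fun p : FBondY i × ι => ιB (blkV1 i.hN i.D p.1))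
      (conj b ((cutMulY (𝔸 := 𝔸) (hBdY i (hTY i c)) * locLetterBY i c parS parB g (chiY i c) V * locP1BY i c parS g (hTY i c) V).restrictScalars ℝ))
      (fun a a' => (M₂ * ∑ j, ‖b j‖) ^ 2 *
        ((if ∃ x : FBondY i, ιB (blkOf i.D.toDomains (chartY i x.src)) = a ∧
              ∃ z : SiteY i, blkCubeY i c z = blkCubeY i c (chartY i x.src) ∧ hTY i c z ≠ 0
            then BG * K1 * Λ * B6.c1 dB δ₀ (a1 - ρ) * B6.c1 dB (ρ * δ₀) α else 0) *
          Real.exp (-((1 - α) * (ρ * δ₀) * (geo9K i).dist a a')))) :=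
  hasMajorant_conj_famFourT_of_core i c parS parB b hM₂ hrepr g hg V ιB hι Rr H Rr' Hp dB
    (mul_nonneg (mul_nonneg (mul_nonneg hBG hK1) hΛ) (c1_nonneg _ _ _)) (mul_nonneg hρ hδ₀) hα1 h261s
    (hasMajorant_core_F4T i c parS parB b V Rr H dB hδ₀ hK1 hBG hΛ hρ hsplit h261 hST hG hP1)

end FamFourT

end Literature.MathematicalPhysics.QuantumFieldTheory.Balaban1983to89.B9Cor36BondSandwichTransferSrc

end
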